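import Mathlib

/-!
# Inverse power series `∑ cₙ y⁻ⁿ` with geometric coefficient bounds

Elementary real-variable toolkit for functions given near `+∞` by a convergent series in inverse
powers, `F(y) = ∑_{n ≥ 0} cₙ y⁻ⁿ`, under a **geometric coefficient bound** `|cₙ| ≤ C Kⁿ`
(the classical *method of majorants*; such `F` is the restriction to `y > K` of a function analytic at
infinity).  For `y > K`:

* `summable_ips`, `ipsEval` : absolute convergence and the sum;
* `abs_ipsEval_le`, `abs_ipsEval_sub_head_le` : `|F(y)| ≤ C y/(y − K)` and the tail bound
  `|F(y) − c₀| ≤ C K/(y − K)`;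
* `ipsEval_add`, `ipsEval_smul`, `ipsEval_cauchy` : linearity and the **Cauchy product**
  `F(y) G(y) = ∑ (c ⋆ d)ₙ y⁻ⁿ`, with the coefficient bound `abs_cauchy_le` :
  `|(c ⋆ d)ₙ| ≤ C D (n+1) Kⁿ` and its geometric relaxation `geomBound_cauchy` at any `K' > K`;
* `hasDerivAt_ipsEval` : termwise differentiation, `F′(y) = ∑ (∂c)ₙ y⁻ⁿ` with
  `(∂c)₀ = 0`, `(∂c)ₙ₊₁ = −n cₙ`, and the bound `geomBound_ipsDeriv`.

These are the facts needed to turn a coefficient recursion (e.g. a Frobenius series at a regular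
singular point at infinity, or the hodograph/shift series of a Darboux–Crum chain) into statements
about actual `C¹` functions on a half-line. [folklore]
-/

noncomputable section

open Filter Topology Finset

namespace Literature.Analysis.Calculus

/-- **Geometric coefficient bound** `|cₙ| ≤ C Kⁿ` (with `C, K ≥ 0`). [folklore] -/
def GeomBound (c : ℕ → ℝ) (C K : ℝ) : Prop :=
  0 ≤ C ∧ 0 ≤ K ∧ ∀ n, |c n| ≤ C * K ^ n

/-- The value `∑ₙ cₙ y⁻ⁿ` of an inverse power series (junk where not summable). [folklore] -/
def ipsEval (c : ℕ → ℝ) (y : ℝ) : ℝ := ∑' n, c n * y⁻¹ ^ n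

/-- The **Cauchy product** of two coefficient sequences: `(c ⋆ d)ₙ = ∑_{i+j=n} cᵢ dⱼ`. [folklore] -/
def cauchy (c d : ℕ → ℝ) (n : ℕ) : ℝ := ∑ ij ∈ antidiagonal n, c ij.1 * d ij.2

/-- Coefficients of the **derivative** of `∑ cₙ y⁻ⁿ`: `(∂c)₀ = 0`, `(∂c)ₙ₊₁ = −n cₙ`
(`d/dy (cₙ y⁻ⁿ) = −n cₙ y⁻ⁿ⁻¹`). [folklore] -/
def ipsDeriv (c : ℕ → ℝ) : ℕ → ℝ
  | 0 => 0
  | n + 1 => -(n : ℝ) * c n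

variable {c d : ℕ → ℝ} {C D K y : ℝ}

/-! ### Summability and size -/

/-- Termwise bound `|cₙ y⁻ⁿ| ≤ C (K/y)ⁿ` for `y > 0`. [folklore] -/
theorem abs_term_le (hc : GeomBound c C K) (hy : 0 < y) (n : ℕ) :
    |c n * y⁻¹ ^ n| ≤ C * (K / y) ^ n := by
  rw [abs_mul, abs_pow, abs_inv, abs_of_pos hy, div_eq_mul_inv, mul_pow]
  have h := hc.2.2 n
  have hK : 0 ≤ K ^ n := pow_nonneg hc.2.1 n
  have hy' : 0 ≤ y⁻¹ ^ n := pow_nonneg (inv_nonneg.2 hy.le) n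
  nlinarith

/-- For `y > K ≥ 0` the ratio `K / y` lies in `[0, 1)`. [folklore] -/
theorem ratio_lt_one (hK : 0 ≤ K) (hy : K < y) : 0 ≤ K / y ∧ K / y < 1 := by
  have hy0 : 0 < y := lt_of_le_of_lt hK hy
  exact ⟨div_nonneg hK hy0.le, (div_lt_one hy0).2 hy⟩

/-- **Absolute convergence** of `∑ cₙ y⁻ⁿ` for `y > K` under `|cₙ| ≤ C Kⁿ`. [folklore] -/
theorem summable_abs_ips (hc : GeomBound c C K) (hy : K < y) :
    Summable fun n => |c n * y⁻¹ ^ n| := by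
  have hy0 : 0 < y := lt_of_le_of_lt hc.2.1 hy
  obtain ⟨h0, h1⟩ := ratio_lt_one hc.2.1 hy
  refine Summable.of_nonneg_of_le (fun n => abs_nonneg _) (fun n => abs_term_le hc hy0 n) ?_
  exact (summable_geometric_of_lt_one h0 h1).mul_left C

/-- Convergence of `∑ cₙ y⁻ⁿ` for `y > K`. [folklore] -/
theorem summable_ips (hc : GeomBound c C K) (hy : K < y) : Summable fun n => c n * y⁻¹ ^ n :=
  (summable_abs_ips hc hy).of_abs

/-- The defining `HasSum`. [folklore] -/
theorem hasSum_ipsEval (hc : GeomBound c C K) (hy : K < y) :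
    HasSum (fun n => c n * y⁻¹ ^ n) (ipsEval c y) :=
  (summable_ips hc hy).hasSum

/-- **Size**: `|∑ cₙ y⁻ⁿ| ≤ C · y/(y − K)` for `y > K`. [folklore] -/
theorem abs_ipsEval_le (hc : GeomBound c C K) (hy : K < y) :
    |ipsEval c y| ≤ C * (y / (y - K)) := by
  have hy0 : 0 < y := lt_of_le_of_lt hc.2.1 hy
  obtain ⟨h0, h1⟩ := ratio_lt_one hc.2.1 hy
  have hgeo : HasSum (fun n => C * (K / y) ^ n) (C * (1 - K / y)⁻¹) :=
    (hasSum_geometric_of_lt_one h0 h1).mul_left C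
  have h1' : ∑' n, |c n * y⁻¹ ^ n| ≤ C * (1 - K / y)⁻¹ := by
    refine hasSum_le (fun n => abs_term_le hc hy0 n) (summable_abs_ips hc hy).hasSum hgeo
  have h2 : |ipsEval c y| ≤ ∑' n, |c n * y⁻¹ ^ n| := by
    unfold ipsEval
    have := norm_tsum_le_tsum_norm (f := fun n => c n * y⁻¹ ^ n) ?_
    · simpa only [Real.norm_eq_abs] using this
    · simpa only [Real.norm_eq_abs] using summable_abs_ips hc hy
  have h3 : (1 - K / y)⁻¹ = y / (y - K) := by
    have hne : y - K ≠ 0 := by linarith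
    field_simp
  rw [← h3]
  exact h2.trans h1'

/-- **Tail bound**: `|∑ cₙ y⁻ⁿ − c₀| ≤ C · K/(y − K)` for `y > K`. [folklore] -/
theorem abs_ipsEval_sub_head_le (hc : GeomBound c C K) (hy : K < y) :
    |ipsEval c y - c 0| ≤ C * (K / (y - K)) := by
  have hy0 : 0 < y := lt_of_le_of_lt hc.2.1 hy
  obtain ⟨h0, h1⟩ := ratio_lt_one hc.2.1 hy
  have hs := summable_ips hc hy
  -- split off the `n = 0` term
  have hsplit : ipsEval c y = c 0 + ∑' n, c (n + 1) * y⁻¹ ^ (n + 1) := by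
    unfold ipsEval
    rw [hs.tsum_eq_zero_add]
    simp
  -- the shifted sequence obeys the bound with constant `C K`... we bound directly
  have htail_abs : Summable fun n => |c (n + 1) * y⁻¹ ^ (n + 1)| :=
    (summable_abs_ips hc hy).comp_injective (add_left_injective 1)
  have hterm : ∀ n, |c (n + 1) * y⁻¹ ^ (n + 1)| ≤ C * (K / y) * (K / y) ^ n := by
    intro n
    have h := abs_term_le hc hy0 (n + 1)
    have e : C * (K / y) ^ (n + 1) = C * (K / y) * (K / y) ^ n := by ring
    rw [e] at h
    exact h
  have hgeo : HasSum (fun n => C * (K / y) * (K / y) ^ n) (C * (K / y) * (1 - K / y)⁻¹) :=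
    (hasSum_geometric_of_lt_one h0 h1).mul_left (C * (K / y))
  have h1' : ∑' n, |c (n + 1) * y⁻¹ ^ (n + 1)| ≤ C * (K / y) * (1 - K / y)⁻¹ :=
    hasSum_le hterm htail_abs.hasSum hgeo
  have h2 : |∑' n, c (n + 1) * y⁻¹ ^ (n + 1)| ≤ ∑' n, |c (n + 1) * y⁻¹ ^ (n + 1)| := by
    have := norm_tsum_le_tsum_norm (f := fun n => c (n + 1) * y⁻¹ ^ (n + 1)) ?_
    · simpa only [Real.norm_eq_abs] using this
    · simpa only [Real.norm_eq_abs] using htail_abs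
  have h3 : C * (K / y) * (1 - K / y)⁻¹ = C * (K / (y - K)) := by
    have hne : y - K ≠ 0 := by linarith
    have hyne : y ≠ 0 := hy0.ne'
    field_simp
  rw [hsplit, add_sub_cancel_left, ← h3]
  exact h2.trans h1'

/-! ### Linearity and the Cauchy product -/

/-- Additivity of evaluation. [folklore] -/
theorem ipsEval_add (hc : GeomBound c C K) (hd : GeomBound d D K) (hy : K < y) :
    ipsEval (fun n => c n + d n) y = ipsEval c y + ipsEval d y := by
  unfold ipsEval
  rw [← (summable_ips hc hy).tsum_add (summable_ips hd hy)]
  congr 1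
  funext n
  ring

/-- Homogeneity of evaluation. [folklore] -/
theorem ipsEval_smul (a : ℝ) (c : ℕ → ℝ) (y : ℝ) :
    ipsEval (fun n => a * c n) y = a * ipsEval c y := by
  unfold ipsEval
  rw [← tsum_mul_left]
  congr 1
  funext n
  ring

/-- A sum bound is monotone in the constants: `GeomBound` with larger `C`. [folklore] -/
theorem GeomBound.mono (hc : GeomBound c C K) {C' : ℝ} (h : C ≤ C') : GeomBound c C' K :=
  ⟨hc.1.trans h, hc.2.1, fun n => (hc.2.2 n).trans (mul_le_mul_of_nonneg_right h (pow_nonneg hc.2.1 n))⟩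

/-- Sums obey the bound with constant `C + D`. [folklore] -/
theorem geomBound_add (hc : GeomBound c C K) (hd : GeomBound d D K) :
    GeomBound (fun n => c n + d n) (C + D) K := by
  refine ⟨add_nonneg hc.1 hd.1, hc.2.1, fun n => ?_⟩
  calc |c n + d n| ≤ |c n| + |d n| := abs_add_le _ _
    _ ≤ C * K ^ n + D * K ^ n := add_le_add (hc.2.2 n) (hd.2.2 n)
    _ = (C + D) * K ^ n := by ring

/-- Scalar multiples obey the bound with constant `|a| C`. [folklore] -/
theorem geomBound_smul (hc : GeomBound c C K) (a : ℝ) :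
    GeomBound (fun n => a * c n) (|a| * C) K := by
  refine ⟨mul_nonneg (abs_nonneg a) hc.1, hc.2.1, fun n => ?_⟩
  rw [abs_mul, mul_assoc]
  exact mul_le_mul_of_nonneg_left (hc.2.2 n) (abs_nonneg a)

/-- **Cauchy product coefficient bound**: `|(c ⋆ d)ₙ| ≤ C D (n+1) Kⁿ`. [folklore] -/
theorem abs_cauchy_le (hc : GeomBound c C K) (hd : GeomBound d D K) (n : ℕ) :
    |cauchy c d n| ≤ C * D * ((n : ℝ) + 1) * K ^ n := by
  unfold cauchy
  calc |∑ ij ∈ antidiagonal n, c ij.1 * d ij.2|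
      ≤ ∑ ij ∈ antidiagonal n, |c ij.1 * d ij.2| := abs_sum_le_sum_abs _ _
    _ ≤ ∑ ij ∈ antidiagonal n, C * D * K ^ n := by
        refine sum_le_sum fun ij hij => ?_
        rw [Finset.HasAntidiagonal.mem_antidiagonal] at hij
        rw [abs_mul]
        calc |c ij.1| * |d ij.2| ≤ (C * K ^ ij.1) * (D * K ^ ij.2) :=
              mul_le_mul (hc.2.2 _) (hd.2.2 _) (abs_nonneg _) (mul_nonneg hc.1 (pow_nonneg hc.2.1 _))
          _ = C * D * K ^ (ij.1 + ij.2) := by rw [pow_add]; ring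
          _ = C * D * K ^ n := by rw [hij]
    _ = C * D * ((n : ℝ) + 1) * K ^ n := by
        rw [sum_const, Finset.Nat.card_antidiagonal, nsmul_eq_mul]
        push_cast
        ring

/-- The polynomial factor is absorbed by any strictly larger ratio:
`(n+1) Kⁿ ≤ (K'/(K' − K)) · K'ⁿ` for `0 ≤ K < K'` (from `(n+1) tⁿ (1−t) ≤ 1`, `t = K/K'`). [folklore] -/
theorem succ_mul_pow_le {K K' : ℝ} (hK : 0 ≤ K) (hKK' : K < K') (n : ℕ) :
    ((n : ℝ) + 1) * K ^ n ≤ (K' / (K' - K)) * K' ^ n := by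
  have hK' : 0 < K' := lt_of_le_of_lt hK hKK'
  have hsub : 0 < K' - K := by linarith
  -- with t = K/K' ∈ [0,1): (n+1) t^n (1 - t) ≤ ∑_{i ≤ n} t^i (1-t) = 1 - t^{n+1} ≤ 1
  set t : ℝ := K / K' with ht
  have ht0 : 0 ≤ t := div_nonneg hK hK'.le
  have ht1 : t < 1 := (div_lt_one hK').2 hKK'
  have hkey : ((n : ℝ) + 1) * t ^ n * (1 - t) ≤ 1 := by
    have hmono : ∀ i ∈ range (n + 1), t ^ n ≤ t ^ i := fun i hi =>
      pow_le_pow_of_le_one ht0 ht1.le (Nat.lt_succ_iff.mp (mem_range.mp hi))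
    have hsum : ((n : ℝ) + 1) * t ^ n ≤ ∑ i ∈ range (n + 1), t ^ i := by
      calc ((n : ℝ) + 1) * t ^ n = ∑ _i ∈ range (n + 1), t ^ n := by
            rw [sum_const, card_range, nsmul_eq_mul]; push_cast; ring
        _ ≤ ∑ i ∈ range (n + 1), t ^ i := sum_le_sum hmono
    have hgeom : (∑ i ∈ range (n + 1), t ^ i) * (1 - t) = 1 - t ^ (n + 1) := by
      rw [show (1 - t) = -(t - 1) by ring, mul_neg, geom_sum_mul]
      ring
    calc ((n : ℝ) + 1) * t ^ n * (1 - t) ≤ (∑ i ∈ range (n + 1), t ^ i) * (1 - t) :=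
          mul_le_mul_of_nonneg_right hsum (by linarith)
      _ = 1 - t ^ (n + 1) := hgeom
      _ ≤ 1 := by linarith [pow_nonneg ht0 (n + 1)]
  -- translate back
  have htn : t ^ n = K ^ n / K' ^ n := by rw [ht, div_pow]
  have h1t : 1 - t = (K' - K) / K' := by rw [ht]; field_simp
  rw [htn, h1t] at hkey
  have hK'n : 0 < K' ^ n := pow_pos hK' n
  rw [div_mul_eq_mul_div, le_div_iff₀ hsub]
  have : ((n : ℝ) + 1) * (K ^ n / K' ^ n) * ((K' - K) / K') =
      ((n : ℝ) + 1) * K ^ n * (K' - K) / (K' ^ n * K') := by ring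
  rw [this, div_le_one (by positivity)] at hkey
  calc ((n : ℝ) + 1) * K ^ n * (K' - K) ≤ K' ^ n * K' := hkey
    _ = K' * K' ^ n := by ring

/-- **Geometric bound for the Cauchy product** at any larger ratio `K' > K`:
`|(c ⋆ d)ₙ| ≤ (C D K'/(K' − K)) K'ⁿ`. [folklore] -/
theorem geomBound_cauchy (hc : GeomBound c C K) (hd : GeomBound d D K) {K' : ℝ} (hKK' : K < K') :
    GeomBound (cauchy c d) (C * D * (K' / (K' - K))) K' := by
  have hK' : 0 < K' := lt_of_le_of_lt hc.2.1 hKK'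
  refine ⟨mul_nonneg (mul_nonneg hc.1 hd.1) (div_nonneg hK'.le (by linarith)), hK'.le, fun n => ?_⟩
  calc |cauchy c d n| ≤ C * D * ((n : ℝ) + 1) * K ^ n := abs_cauchy_le hc hd n
    _ = C * D * (((n : ℝ) + 1) * K ^ n) := by ring
    _ ≤ C * D * ((K' / (K' - K)) * K' ^ n) :=
        mul_le_mul_of_nonneg_left (succ_mul_pow_le hc.2.1 hKK' n) (mul_nonneg hc.1 hd.1)
    _ = C * D * (K' / (K' - K)) * K' ^ n := by ring

/-- **Cauchy product = product of sums**: `(∑ cₙ y⁻ⁿ)(∑ dₙ y⁻ⁿ) = ∑ (c ⋆ d)ₙ y⁻ⁿ` for `y > K`.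
[folklore] -/
theorem ipsEval_mul (hc : GeomBound c C K) (hd : GeomBound d D K) (hy : K < y) :
    ipsEval c y * ipsEval d y = ipsEval (cauchy c d) y := by
  unfold ipsEval cauchy
  have hcn : Summable fun n => ‖c n * y⁻¹ ^ n‖ := by
    simpa only [Real.norm_eq_abs] using summable_abs_ips hc hy
  have hdn : Summable fun n => ‖d n * y⁻¹ ^ n‖ := by
    simpa only [Real.norm_eq_abs] using summable_abs_ips hd hy
  rw [tsum_mul_tsum_eq_tsum_sum_antidiagonal_of_summable_norm hcn hdn]
  congr 1
  funext n
  rw [sum_mul]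
  refine sum_congr rfl fun ij hij => ?_
  rw [Finset.HasAntidiagonal.mem_antidiagonal] at hij
  rw [← hij, pow_add]
  ring

/-! ### Differentiation -/

/-- The derivative coefficients obey `|(∂c)ₙ₊₁| = n |cₙ| ≤ C n Kⁿ`, hence at any `K' > K` the
geometric bound `GeomBound (∂c) (C/(K' − K)) K'`. [folklore] -/
theorem geomBound_ipsDeriv (hc : GeomBound c C K) {K' : ℝ} (hKK' : K < K') :
    GeomBound (ipsDeriv c) (C / (K' - K)) K' := by
  have hK' : 0 < K' := lt_of_le_of_lt hc.2.1 hKK'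
  have hsub : 0 < K' - K := by linarith
  refine ⟨div_nonneg hc.1 hsub.le, hK'.le, fun n => ?_⟩
  cases n with
  | zero =>
    simp only [ipsDeriv, abs_zero]
    exact mul_nonneg (div_nonneg hc.1 hsub.le) (pow_nonneg hK'.le _)
  | succ n =>
    simp only [ipsDeriv]
    rw [abs_mul, abs_neg, Nat.abs_cast]
    have h1 : (n : ℝ) * |c n| ≤ C * (((n : ℝ) + 1) * K ^ n) := by
      have := hc.2.2 n
      have hn : (0 : ℝ) ≤ n := Nat.cast_nonneg n
      nlinarith [abs_nonneg (c n)]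
    have h2 := succ_mul_pow_le hc.2.1 hKK' n
    calc (n : ℝ) * |c n| ≤ C * (((n : ℝ) + 1) * K ^ n) := h1
      _ ≤ C * ((K' / (K' - K)) * K' ^ n) := mul_le_mul_of_nonneg_left h2 hc.1
      _ = C / (K' - K) * K' ^ (n + 1) := by rw [pow_succ]; field_simp


/-- **Termwise differentiation**: for `y > K`, `d/dy ∑ cₙ y⁻ⁿ = ∑ (∂c)ₙ y⁻ⁿ`. [folklore] -/
theorem hasDerivAt_ipsEval (hc : GeomBound c C K) (hy : K < y) :
    HasDerivAt (ipsEval c) (ipsEval (ipsDeriv c) y) y := by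
  have hK0 : 0 ≤ K := hc.2.1
  -- an intermediate radius `K < K' < y`
  set K' : ℝ := (K + y) / 2 with hK'def
  have hKK' : K < K' := by rw [hK'def]; linarith
  have hK'y : K' < y := by rw [hK'def]; linarith
  have hK'0 : 0 < K' := lt_of_le_of_lt hK0 hKK'
  -- the terms, their derivatives and the dominating sequence on `Ioi K'`
  set f : ℕ → ℝ → ℝ := fun n x => c n * x⁻¹ ^ n with hf
  set f' : ℕ → ℝ → ℝ := fun n x => c n * ((n : ℝ) * x⁻¹ ^ (n - 1) * (-(x ^ 2)⁻¹)) with hf'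
  set u : ℕ → ℝ := fun n => C / K' * ((n : ℝ) ^ 1 * (K / K') ^ n) with hu
  have hderiv : ∀ n x, x ∈ Set.Ioi K' → HasDerivAt (f n) (f' n x) x := by
    intro n x hx
    have hx0 : x ≠ 0 := (lt_trans hK'0 hx).ne'
    exact ((hasDerivAt_inv hx0).pow n).const_mul (c n)
  have hbound : ∀ n x, x ∈ Set.Ioi K' → ‖f' n x‖ ≤ u n := by
    intro n x hx
    have hxK' : K' < x := hx
    have hx0 : 0 < x := lt_trans hK'0 hxK'
    rw [Real.norm_eq_abs, hf']
    simp only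
    cases n with
    | zero => simp [hu]
    | succ n =>
      simp only [Nat.add_sub_cancel, Nat.cast_succ]
      rw [abs_mul, abs_mul, abs_mul, abs_neg, abs_inv, abs_pow, abs_inv, abs_of_pos hx0,
        abs_of_pos (pow_pos hx0 2), abs_of_nonneg (by positivity : (0:ℝ) ≤ (n:ℝ) + 1)]
      -- |c (n+1)| (n+1) x⁻¹^n (x²)⁻¹ ≤ C (n+1) K^{n+1}/K'^{n+2} = u (n+1)
      have hcn := hc.2.2 (n + 1)
      have hxinv : x⁻¹ ≤ K'⁻¹ := (inv_le_inv₀ hx0 hK'0).2 hxK'.le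
      have hxinv0 : 0 ≤ x⁻¹ := inv_nonneg.2 hx0.le
      have h1 : x⁻¹ ^ n ≤ K'⁻¹ ^ n := pow_le_pow_left₀ hxinv0 hxinv n
      have h2 : (x ^ 2)⁻¹ ≤ (K' ^ 2)⁻¹ :=
        (inv_le_inv₀ (pow_pos hx0 2) (pow_pos hK'0 2)).2 (pow_le_pow_left₀ hK'0.le hxK'.le 2)
      have hK'inv : 0 ≤ K'⁻¹ ^ n := pow_nonneg (inv_nonneg.2 hK'0.le) n
      calc |c (n + 1)| * (((n : ℝ) + 1) * x⁻¹ ^ n * (x ^ 2)⁻¹)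
          ≤ (C * K ^ (n + 1)) * (((n : ℝ) + 1) * K'⁻¹ ^ n * (K' ^ 2)⁻¹) := by
            refine mul_le_mul hcn ?_ (by positivity) (mul_nonneg hc.1 (pow_nonneg hK0 _))
            refine mul_le_mul (mul_le_mul_of_nonneg_left h1 (by positivity)) h2 (by positivity)
              (by positivity)
        _ = u (n + 1) := by
            have hK'ne : K' ≠ 0 := hK'0.ne'
            simp only [hu, Nat.cast_succ, pow_one, inv_pow, div_pow]
            field_simp
            ring
  have hu_sum : Summable u := by
    have hr : ‖K / K'‖ < 1 := by
      rw [Real.norm_eq_abs, abs_of_nonneg (div_nonneg hK0 hK'0.le)]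
      exact (div_lt_one hK'0).2 hKK'
    exact (summable_pow_mul_geometric_of_norm_lt_one 1 hr).mul_left (C / K')
  have hopen : IsOpen (Set.Ioi K') := isOpen_Ioi
  have hconn : IsPreconnected (Set.Ioi K') := isPreconnected_Ioi
  have hy_mem : y ∈ Set.Ioi K' := hK'y
  have hf0 : Summable (f · y) := summable_ips hc hy
  have hmain := hasDerivAt_tsum_of_isPreconnected hu_sum hopen hconn hderiv hbound hy_mem hf0 hy_mem
  -- identify the function and the derivative value
  have hfun : (fun x => ∑' n, f n x) = ipsEval c := by
    funext x; rfl
  rw [hfun] at hmain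
  have hGeom := geomBound_ipsDeriv hc hKK'
  have hval : (∑' n, f' n y) = ipsEval (ipsDeriv c) y := by
    have hsG : Summable fun m => ipsDeriv c m * y⁻¹ ^ m := summable_ips hGeom hK'y
    unfold ipsEval
    rw [hsG.tsum_eq_zero_add]
    have h0 : ipsDeriv c 0 * y⁻¹ ^ 0 = 0 := by simp [ipsDeriv]
    rw [h0, zero_add]
    refine tsum_congr fun n => ?_
    have hy0 : y ≠ 0 := (lt_trans hK'0 hK'y).ne'
    simp only [hf', ipsDeriv]
    cases n with
    | zero => simp
    | succ n =>
      simp only [Nat.add_sub_cancel, Nat.cast_succ, inv_pow]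
      field_simp
      ring
  rw [hval] at hmain
  exact hmain

/-- The sum is differentiable, hence continuous, on `(K, ∞)`. [folklore] -/
theorem continuousOn_ipsEval (hc : GeomBound c C K) : ContinuousOn (ipsEval c) (Set.Ioi K) :=
  fun _y hy => (hasDerivAt_ipsEval hc hy).continuousAt.continuousWithinAt

/-- The derivative of the sum on `(K, ∞)`. [folklore] -/
theorem deriv_ipsEval (hc : GeomBound c C K) (hy : K < y) :
    deriv (ipsEval c) y = ipsEval (ipsDeriv c) y :=
  (hasDerivAt_ipsEval hc hy).deriv

end Literature.Analysis.Calculus
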